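import Literature.Probability.RandomPlanarGeometry.SLEBubblesCloud
import Literature.Probability.RandomPlanarGeometry.SLEBubblesVersion
import Literature.Probability.RandomPlanarGeometry.HullDecomposition
import HarnessLib

/-!
# [LSW] Theorem 7.3, the avoidance formula (7.3): the printed proof's three steps, with the measure theory PROVED

Decomposition of the named fact
`Literature.Probability.RandomPlanarGeometry.SLEBubbles.measure_disjoint` (file `SLEBubbles`:
for `0 < κ ≤ 8/3`, a Brownian bubble measure `μ`, an independent Poisson cloud `X` with mean
`λ_κ μ ⊗ dt` and `A ∈ 𝒬*` with restriction data `(Φ_A, d)`,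
`(preWienerMeasure ⊗ P') {Ξ(κ) ∩ A = ∅} = d^{α_κ}`), after

* G. F. Lawler, O. Schramm, W. Werner, *Conformal restriction: the chordal case*, J. Amer. Math.
  Soc. **16** (2003) 917–955, arXiv:math/0209343 (**[LSW]**), §7.2 (pp. 28–29), whose proof of
  (7.3) reads, verbatim: "Let `A ∈ 𝒬*`, and let `h_t` be the normalized conformal map from
  `ℍ ∖ g_t(A)` onto `ℍ` as in §5. By (7.2), for any `t > 0` on the event `γ[0,t] ∩ A = ∅`,
  `P[{K : g_t⁻¹(K + W_t) ∩ A ≠ ∅} | g_t] = P[{K : (K + W_t) ∩ g_t(A) ≠ ∅} | g_t] = −Sh_t(W_t)/6`,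
  where `K` is independent from `γ` and has law `μ`. Consequently, on the event
  `γ[0, ∞) ∩ A = ∅`, `P[Ξ ∩ A = ∅ | γ] = exp(λ ∫₀^∞ Sh_t(W_t)/6 dt)`. By taking expectation and
  applying Theorem 6.5, we get (7.3) `P[Ξ ∩ A = ∅] = Φ_A'(0)^α`", with **Theorem 6.5** (§6):
  "Suppose `0 ≤ κ ≤ 8/3` and let `α` and `λ` be as in (5.2) and (5.3). If `W_t = √κ B_t` and
  `A ∈ 𝒬*`, then `Φ_A'(0)^α = E[1_{γ[0,∞) ∩ A = ∅} exp(λ ∫₀^∞ Sh_s(W_s)/6 ds)]`";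
* J. F. C. Kingman, *Poisson Processes* (1993), §2.1: `P{N(A) = 0} = e^{−μ(A)}`, with the
  convention that `𝒫(∞)` is concentrated at `∞` (the tree's `IsPoissonCloud`).

With `E = {(ω, ω') : Ξ(κ)(ω, X(ω')) ∩ A = ∅}`, `G = {ω : γ[0, ∞) ∩ A = ∅}` and, for a driving
sample `ω`, the set `s_ω = {(K, t) : g_t⁻¹(K + W_t) ∩ A ≠ ∅} ⊆ Ω_b × [0, ∞)` of bubbles-with-times
whose attached bubble hits `A` (`bubbleHitSet`; its time sections are the sets
`{K : g_t⁻¹(K + W_t) ∩ A ≠ ∅}` of the display, `bubbleHitFibre`), the printed argument is: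

1. (filling) `Ξ ∩ A = ∅ ⟺ γ ∩ A = ∅` and `X ∩ s_ω = ∅` — PROVED (`disjoint_sleBubbleSet_iff`):
   `F^ℝ_ℍ` only adds components of `ℍ̄ ∖ (γ ∪ ⋃ X̂)` missing `ℝ`, and every component of a
   `*`-hull meets `ℝ` (`IsStarHull.disjoint_twoSidedFilling_iff`, from the tree's
   `IsStarHull.exists_real_mem_connectedComponentIn`);
2. (Poisson) "`P[Ξ ∩ A = ∅ | γ] = exp(−λ (μ ⊗ dt)(s_ω))`" — PROVED for measurable `s`, including
   `e^{−∞} = 0` (`poissonAvoidance`, `measure_cloud_inter_eq_empty`), together with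
   `(μ ⊗ dt)(s_ω) = ∫₀^∞ μ{K : g_t⁻¹(K + W_t) ∩ A ≠ ∅} dt` (Tonelli; `μ` is σ-finite,
   `IsBrownianBubbleMeasure.sigmaFinite` of `SLEBubblesCloud`) and "taking expectation"
   `(P ⊗ P')(E) = ∫ P'(E_ω) dP(ω)` (Fubini) — these need the two measurability statements that
   [LSW] leave implicit: the NAMED FACT `SLEBubbles.nullMeasurableSet_disjoint` of the sibling
   file `SLEBubblesVersion` (the event `{Ξ ∩ A = ∅}` is measurable up to a null set in the
   product space; it follows from `SLEBubbles.exists_measurable_version`, "`Ξ(κ)` is a random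
   element of `Ω`", `SLEBubbles.nullMeasurableSet_disjoint_of` there) and the NAMED FACT
   `SLEBubbles.ae_measurableSet_bubbleHitSet` vendored here (for a.e. `γ` missing `A`, `s_ω` is
   measurable for the mean measure);
3. (Theorem 6.5) the NAMED FACT `SLEBubbles.lintegral_poissonAvoidance_eq_rpow` — Thm. 6.5 with
   its integrand `−Sh_t(W_t)/6` written, exactly as the first display above reads it through
   (7.2), as `μ{K : g_t⁻¹(K + W_t) ∩ A ≠ ∅}`:
   `E[1_{γ ∩ A = ∅} exp(−λ_κ ∫₀^∞ μ{K : g_t⁻¹(K + W_t) ∩ A ≠ ∅} dt)] = Φ_A'(0)^{α_κ}`. This is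
   the deep input (Prop. 5.3: Itô's formula makes `h_t'(W_t)^α exp(λ ∫₀ᵗ Sh_s(W_s)/6 ds)` a
   bounded martingale; Lemmas 6.2–6.3; (7.2) for the slid hulls `g_t(A) − W_t`), left for its
   own decomposition.

Main result (PROVED): `SLEBubbles.measure_disjoint_of_leaves` — (7.3) from the three named facts —
and `SLEBubbles.measure_disjoint_of_version` — (7.3) from `SLEBubbles.exists_measurable_version`,
`SLEBubbles.ae_measurableSet_bubbleHitSet` and the Thm. 6.5 fact. Sanity checks (PROVED): the
Thm. 6.5 fact holds for the empty hull (`Φ_∅ = id`, both sides are `1`), and the fibre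
measurability fact holds trivially there.

Mathlib: `Measure.prod_apply`, `Measure.prod_apply_symm`, `Measure.ae_ae_of_ae_prod`,
`NullMeasurableSet.exists_measurable_subset_ae_eq`.
-/

noncomputable section

open Set Filter MeasureTheory
open UpperHalfPlane (upperHalfPlaneSet)
open scoped NNReal ENNReal Topology
open Literature.Probability.Process (preWienerMeasure IsPoissonCloud)

namespace Literature.Probability.RandomPlanarGeometry

/-! ### Poisson avoidance probabilities `e^{−m}`, `e^{−∞} = 0` (Kingman §2.1) -/

/-- **`e^{−m}` for `m ∈ [0, ∞]`, with `e^{−∞} = 0`**: the probability that a Poisson variable of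
mean `m` vanishes, `P{N(A) = 0} = e^{−μ(A)}`, with Kingman's convention that `𝒫(∞)` is
concentrated at `∞` (so that `P{N(A) = 0} = 0` when `μ(A) = ∞`). [cite: Kingman1993, §2.1] -/
def poissonAvoidance (m : ℝ≥0∞) : ℝ≥0∞ :=
  if m = ∞ then 0 else ENNReal.ofReal (Real.exp (-m.toReal))

/-- `e^{−∞} = 0`. [cite: Kingman1993, §2.1] -/
@[simp] theorem poissonAvoidance_top : poissonAvoidance ∞ = 0 := by
  simp [poissonAvoidance]

/-- `e^{−m}` for finite `m`. [cite: Kingman1993, §2.1] -/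
theorem poissonAvoidance_of_ne_top {m : ℝ≥0∞} (hm : m ≠ ∞) :
    poissonAvoidance m = ENNReal.ofReal (Real.exp (-m.toReal)) := by
  simp [poissonAvoidance, hm]

/-- `e^{−0} = 1`. [folklore] -/
@[simp] theorem poissonAvoidance_zero : poissonAvoidance 0 = 1 := by
  simp [poissonAvoidance]

/-- `e^{−m} ≤ 1`. [folklore] -/
theorem poissonAvoidance_le_one (m : ℝ≥0∞) : poissonAvoidance m ≤ 1 := by
  unfold poissonAvoidance
  split_ifs with h
  · exact zero_le_one
  · exact ENNReal.ofReal_le_one.2 (Real.exp_le_one_iff.2 (neg_nonpos.2 ENNReal.toReal_nonneg))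

/-- **Avoidance probabilities of a Poisson cloud, for every measurable set** (Kingman 1993,
§2.1: `P{N(A) = 0} = e^{−μ(A)}`): `P[X ∩ s = ∅] = e^{−Λ(s)}`, the case `Λ(s) = ∞` included
(`N(s) = ∞` a.s. there, so the avoidance event is null); the tree's
`IsPoissonCloud.measure_inter_eq_empty` is the case `Λ(s) < ∞`. [cite: Kingman1993, §2.1] -/
theorem measure_cloud_inter_eq_empty {Ω E : Type*} [MeasurableSpace Ω] [MeasurableSpace E]
    {Λ : Measure E} {X : Ω → Set E} {P : Measure Ω} (hX : IsPoissonCloud Λ X P)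
    {s : Set E} (hs : MeasurableSet s) :
    P {ω | X ω ∩ s = ∅} = poissonAvoidance (Λ s) := by
  by_cases hΛ : Λ s = ∞
  · rw [hΛ, poissonAvoidance_top]
    refine measure_mono_null (fun ω (hω : X ω ∩ s = ∅) ↦ ?_) (ae_iff.1 (hX.ae_encard_eq_top hs hΛ))
    show ¬ (X ω ∩ s).encard = ⊤
    simp [hω]
  · rw [poissonAvoidance_of_ne_top hΛ]
    exact hX.measure_inter_eq_empty hs hΛ

/-! ### The filling is irrelevant for avoiding a `*`-hull -/

/-- **`F^ℝ_ℍ(C)` misses a `*`-hull `A` iff `C` does**: every point of `A ⊆ ℍ̄` is joined inside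
`A` to a real point of `A` (every component of a `*`-hull meets `ℝ`,
`IsStarHull.exists_real_mem_connectedComponentIn` with `IsBoundedHull.isConnected_union_im_nonpos`),
so if `C ∩ A = ∅` it lies in the component of `ℍ̄ ∖ C` of a real point, off the filling; conversely
`C ∩ ℍ̄ ⊆ F^ℝ_ℍ(C)` and `A ⊆ ℍ̄`. (The one-sided analogue is the tree's
`IsPlusHull.disjoint_leftFilling_iff`.) [folklore] -/
theorem IsStarHull.disjoint_twoSidedFilling_iff {A : Set ℂ} (hA : IsStarHull A) (C : Set ℂ) :
    Disjoint (twoSidedFilling C) A ↔ Disjoint C A := by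
  have hAim : ∀ z ∈ A, 0 ≤ z.im := fun z hz ↦ hA.isBoundedHull.im_nonneg hz
  constructor
  · intro h
    refine Set.disjoint_left.2 fun z hzC hzA ↦ ?_
    exact Set.disjoint_left.1 h (inter_subset_twoSidedFilling C ⟨hzC, hAim z hzA⟩) hzA
  · intro h
    refine Set.disjoint_left.2 fun z hzF hzA ↦ ?_
    obtain ⟨x, -, hx⟩ := hA.exists_real_mem_connectedComponentIn
      hA.isBoundedHull.isConnected_union_im_nonpos hzA
    -- the component of `z` in `A` lies in `ℍ̄ ∖ C` and contains the real point `x`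
    have hsub : connectedComponentIn A z ⊆ {z : ℂ | 0 ≤ z.im} \ C := fun w hw ↦
      ⟨hAim w (connectedComponentIn_subset _ _ hw),
        fun hwC ↦ Set.disjoint_left.1 h hwC (connectedComponentIn_subset _ _ hw)⟩
    have hzx : z ∈ connectedComponentIn ({z : ℂ | 0 ≤ z.im} \ C) x :=
      (isPreconnected_connectedComponentIn.subset_connectedComponentIn hx hsub)
        (mem_connectedComponentIn hzA)
    exact (mem_twoSidedFilling_iff.1 hzF).2 x hzx

/-! ### The bubbles-with-times whose attached bubble hits `A` ([LSW] §7.2) -/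

/-- **The set `s_ω = {(K, t) ∈ Ω_b × [0, ∞) : g_t⁻¹(K + W_t) ∩ A ≠ ∅}`** of bubbles-with-times
whose bubble, attached to SLE_κ at its time (`attachedBubble`), hits `A` — the subset of the
state space of the cloud `X` that `X` must avoid for `⋃ X̂` to miss `A` ([LSW] §7.2, pp. 28–29:
"`P[{K : g_t⁻¹(K + W_t) ∩ A ≠ ∅} | g_t]`", integrated over `t` in
"`P[Ξ ∩ A = ∅ | γ] = exp(λ ∫₀^∞ Sh_t(W_t)/6 dt)`").
[cite: LawlerSchrammWerner2003Restriction, §7.2 (pp. 28–29, proof of (7.3))] -/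
def bubbleHitSet (κ : ℝ≥0) (ω : ℝ≥0 → ℝ) (A : Set ℂ) : Set (BubbleConfig × ℝ≥0) :=
  {q | ¬ Disjoint (attachedBubble κ ω (q.1 : Set ℂ) q.2) A}

/-- **The time-`t` section `{K ∈ Ω_b : g_t⁻¹(K + W_t) ∩ A ≠ ∅}` of `bubbleHitSet`** — the set
whose `μ`-mass is "`P[{K : g_t⁻¹(K + W_t) ∩ A ≠ ∅} | g_t] = −Sh_t(W_t)/6`" in [LSW] §7.2 (pp. 28–29).
[cite: LawlerSchrammWerner2003Restriction, §7.2 (pp. 28–29, proof of (7.3))] -/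
def bubbleHitFibre (κ : ℝ≥0) (ω : ℝ≥0 → ℝ) (A : Set ℂ) (t : ℝ≥0) : Set BubbleConfig :=
  {K | ¬ Disjoint (attachedBubble κ ω (K : Set ℂ) t) A}

section HitSet

variable {κ : ℝ≥0} {ω : ℝ≥0 → ℝ} {A : Set ℂ}

/-- Membership in `bubbleHitSet`. [folklore] -/
@[simp] theorem mem_bubbleHitSet_iff {q : BubbleConfig × ℝ≥0} :
    q ∈ bubbleHitSet κ ω A ↔ ¬ Disjoint (attachedBubble κ ω (q.1 : Set ℂ) q.2) A := Iff.rfl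

/-- Membership in `bubbleHitFibre`. [folklore] -/
@[simp] theorem mem_bubbleHitFibre_iff {K : BubbleConfig} {t : ℝ≥0} :
    K ∈ bubbleHitFibre κ ω A t ↔ ¬ Disjoint (attachedBubble κ ω (K : Set ℂ) t) A := Iff.rfl

/-- The time sections of `bubbleHitSet` are the fibres `bubbleHitFibre` (definitionally). [folklore] -/
theorem mk_preimage_bubbleHitSet (t : ℝ≥0) :
    (fun K : BubbleConfig ↦ (K, t)) ⁻¹' bubbleHitSet κ ω A = bubbleHitFibre κ ω A t := rfl

variable (κ ω)

/-- No attached bubble hits the empty hull. [folklore] -/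
@[simp] theorem bubbleHitSet_empty : bubbleHitSet κ ω ∅ = ∅ := by
  ext q
  simp

/-- No attached bubble hits the empty hull (fibres). [folklore] -/
@[simp] theorem bubbleHitFibre_empty (t : ℝ≥0) : bubbleHitFibre κ ω ∅ t = ∅ := by
  ext K
  simp

/-- The SLE trace misses a set off the origin iff its restriction to positive times does
(`γ(0) = W_0 = 0`). [folklore] -/
theorem disjoint_range_sleTrace_iff (h0 : (0 : ℂ) ∉ A) :
    Disjoint (range (sleTrace κ ω)) A ↔ Disjoint (sleTrace κ ω '' Ioi 0) A := by
  refine ⟨fun h ↦ h.mono_left (image_subset_range _ _), fun h ↦ Set.disjoint_left.2 ?_⟩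
  rintro _ ⟨t, rfl⟩ ht
  rcases eq_or_ne t 0 with rfl | hne
  · refine h0 ?_
    have h00 : sleTrace κ ω 0 = 0 := by
      change Loewner.trace (sleDriving κ ω) 0 = 0
      rw [Loewner.trace_zero, sleDriving_zero, Complex.ofReal_zero]
    rwa [h00] at ht
  · exact Set.disjoint_left.1 h ⟨t, pos_iff_ne_zero.2 hne, rfl⟩ ht

/-- **Step 1 of the proof of (7.3): `Ξ(κ) ∩ A = ∅` iff the trace misses `A` and no point of the
cloud lies in `s_ω`** (`Ξ = F^ℝ_ℍ(γ(0, ∞) ∪ ⋃ X̂)`, the filling being irrelevant for the `*`-hull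
`A`, `IsStarHull.disjoint_twoSidedFilling_iff`). [cite: LawlerSchrammWerner2003Restriction, §7.2 (pp. 28–29, proof of (7.3))] -/
theorem disjoint_sleBubbleSet_iff (hA : IsStarHull A) (Xc : Set (BubbleConfig × ℝ≥0)) :
    Disjoint (sleBubbleSet κ ω Xc) A ↔
      Disjoint (range (sleTrace κ ω)) A ∧ Xc ∩ bubbleHitSet κ ω A = ∅ := by
  rw [sleBubbleSet, hA.disjoint_twoSidedFilling_iff, disjoint_union_left,
    disjoint_range_sleTrace_iff κ ω hA.zero_notMem, disjoint_iUnion₂_left]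
  refine and_congr_right fun _ ↦ ?_
  simp only [eq_empty_iff_forall_notMem, mem_inter_iff, mem_bubbleHitSet_iff, not_and, not_not]

end HitSet

/-! ### The measurability of `s_ω` and Theorem 6.5, as named facts -/

/-- NAMED FACT — **`s_ω` is measurable for the mean measure, for almost every `γ` missing `A`**
(implicit in [LSW] §7.2, pp. 28–29: "Consequently, on the event `γ[0, ∞) ∩ A = ∅`,
`P[Ξ ∩ A = ∅ | γ] = exp(λ ∫₀^∞ Sh_t(W_t)/6 dt)`" applies "the properties of Poisson point
processes" (the footnote of Rem. 7.2, p. 28: counts of MEASURABLE sets of bubbles) to the set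
`s_ω = {(K, t) : g_t⁻¹(K + W_t) ∩ A ≠ ∅}`): for `0 < κ ≤ 8/3` and `A ∈ 𝒬*`, for
`preWienerMeasure`-a.e. `ω` whose trace misses `A`, `bubbleHitSet κ ω A` is measurable in
`Ω_b × [0, ∞)` (σ-field of `Ω_b`: generated by the avoidance events of `*`-hulls, §7.1 with §3
p. 10). Why it holds: for such `ω` the chain is generated by a simple curve ([RS], `κ ≤ 8/3`),
the time sections are the hitting events of the slid hulls `g_t(A) − W_t ∈ 𝒬*`, which move
continuously in `t`. [cite: LawlerSchrammWerner2003Restriction, §7.2 (pp. 28–29, proof of (7.3)) with the footnote of Rem. 7.2 (p. 28)] -/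
def SLEBubbles.ae_measurableSet_bubbleHitSet : Prop :=
  ∀ {κ : ℝ≥0}, 0 < κ → κ ≤ 8 / 3 → ∀ {A : Set ℂ}, IsStarHull A →
    ∀ᵐ ω ∂preWienerMeasure, Disjoint (range (sleTrace κ ω)) A → MeasurableSet (bubbleHitSet κ ω A)

/-- NAMED FACT — **[LSW] Theorem 6.5, read through (7.2) as in the proof of (7.3).** Thm. 6.5
(§6): "Suppose `0 ≤ κ ≤ 8/3` and let `α` and `λ` be as in (5.2) and (5.3)
[`α = (6 − κ)/(2κ)`, `λ = (8 − 3κ)(6 − κ)/(2κ)`]. If `W_t = √κ B_t` and `A ∈ 𝒬*`, then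
`Φ_A'(0)^α = E[1_{γ[0,∞) ∩ A = ∅} exp(λ ∫₀^∞ Sh_s(W_s)/6 ds)]`" (`h_s` the normalized map of
`ℍ ∖ g_s(A)`, §5), where by §7.2 (pp. 28–29, first display of the proof of (7.3), i.e. (7.2) for the hull `g_t(A) − W_t`)
"`P[{K : g_t⁻¹(K + W_t) ∩ A ≠ ∅} | g_t] = −Sh_t(W_t)/6`", `K` of "law" `μ`: for `0 < κ ≤ 8/3`,
a Brownian bubble measure `μ` (a measure with the hitting masses (7.2), `IsBrownianBubbleMeasure`),
`A ∈ 𝒬*` with restriction map `Φ` and `d = Φ'_A(0)`,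
`∫ 1{γ[0,∞) ∩ A = ∅} · exp(−λ_κ ∫₀^∞ μ{K : g_t⁻¹(K + W_t) ∩ A ≠ ∅} dt) d(preWienerMeasure) = d^{α_κ}`,
with `exp(−∞) = 0` (`poissonAvoidance`) and `dt` = `timeMeasure`. The deep input of Thm. 7.3:
in print, Prop. 5.3 (Itô's formula: `Y_t = h_t'(W_t)^α exp(λ ∫₀ᵗ Sh_s(W_s)/6 ds)`, `t < T`, is a
martingale with `0 ≤ Y_t ≤ 1` for `κ ≤ 8/3`) and "a similar proof to that of Theorem 6.1"
(Lemmas 6.2, 6.3, reduction to smooth one-sided hulls); not in Mathlib or the tree for `κ < 8/3`.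
[cite: LawlerSchrammWerner2003Restriction, Thm. 6.5 (§6) with §7.2 (pp. 28–29, proof of (7.3), first display)] -/
def SLEBubbles.lintegral_poissonAvoidance_eq_rpow : Prop :=
  ∀ {κ : ℝ≥0}, 0 < κ → κ ≤ 8 / 3 → ∀ {μ : Measure BubbleConfig}, IsBrownianBubbleMeasure μ →
    ∀ {A : Set ℂ}, IsStarHull A →
      ∀ {Φ : ConformalEquiv (upperHalfPlaneSet \ A) upperHalfPlaneSet}, IsRestrictionMap A Φ →
        ∀ {d : ℝ}, HasRestrictionDeriv A Φ d →
          ∫⁻ ω, {ω | Disjoint (range (sleTrace κ ω)) A}.indicator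
              (fun ω ↦ poissonAvoidance
                (sleBubbleIntensity κ * ∫⁻ t, μ (bubbleHitFibre κ ω A t) ∂timeMeasure)) ω
            ∂preWienerMeasure = ENNReal.ofReal (d ^ sleBubbleExponent κ)

/-! ### Sanity checks at the empty hull -/

/-- The fibre-measurability fact holds for `A = ∅` (`s_ω = ∅`). [folklore] -/
theorem SLEBubbles.measurableSet_bubbleHitSet_empty (κ : ℝ≥0) (ω : ℝ≥0 → ℝ) :
    MeasurableSet (bubbleHitSet κ ω ∅) := by
  simp

/-- **The Thm. 6.5 fact is consistent at `A = ∅`** (`Φ_∅ = id`, `Φ'_∅(0) = 1`): the trace always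
misses `∅`, no bubble hits it, so the left side is `∫ e^{−0} = 1 = 1^{α_κ}`. [folklore] -/
theorem SLEBubbles.lintegral_poissonAvoidance_empty (κ : ℝ≥0) (μ : Measure BubbleConfig) :
    ∫⁻ ω, {ω | Disjoint (range (sleTrace κ ω)) (∅ : Set ℂ)}.indicator
        (fun ω ↦ poissonAvoidance
          (sleBubbleIntensity κ * ∫⁻ t, μ (bubbleHitFibre κ ω ∅ t) ∂timeMeasure)) ω
      ∂preWienerMeasure = ENNReal.ofReal ((1 : ℝ) ^ sleBubbleExponent κ) := by
  haveI : IsProbabilityMeasure preWienerMeasure := isProbabilityMeasure_preWienerMeasure'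
  simp

/-! ### The assembly: (7.3) from the three named facts -/

/-- **Step 2 of the proof of (7.3), the section probabilities**: for a driving sample `ω` whose
set `s_ω` is measurable when the trace misses `A`, the `P'`-probability that `Ξ(κ)(ω, X) ∩ A = ∅`
is `1{γ ∩ A = ∅} e^{−Λ(s_ω)}` with `Λ(s_ω) = λ_κ ∫₀^∞ μ{K : g_t⁻¹(K + W_t) ∩ A ≠ ∅} dt`
("on the event `γ[0, ∞) ∩ A = ∅`, `P[Ξ ∩ A = ∅ | γ] = exp(λ ∫₀^∞ Sh_t(W_t)/6 dt)`": Poisson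
avoidance, `measure_cloud_inter_eq_empty`, and Tonelli, `Measure.prod_apply_symm`, `μ` being
σ-finite). [cite: LawlerSchrammWerner2003Restriction, §7.2 (pp. 28–29, proof of (7.3))] -/
theorem SLEBubbles.measure_section_eq_indicator {κ : ℝ≥0} {μ : Measure BubbleConfig} [SFinite μ]
    {Ω' : Type} [MeasurableSpace Ω'] {P' : Measure Ω'} {X : Ω' → Set (BubbleConfig × ℝ≥0)}
    (hX : IsPoissonCloud (bubbleCloudIntensity κ μ) X P') {A : Set ℂ} (hA : IsStarHull A)
    {ω : ℝ≥0 → ℝ} (hmeas : Disjoint (range (sleTrace κ ω)) A → MeasurableSet (bubbleHitSet κ ω A)) :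
    P' {ω' | Disjoint (sleBubbleSet κ ω (X ω')) A} =
      {ω | Disjoint (range (sleTrace κ ω)) A}.indicator
        (fun ω ↦ poissonAvoidance
          (sleBubbleIntensity κ * ∫⁻ t, μ (bubbleHitFibre κ ω A t) ∂timeMeasure)) ω := by
  simp_rw [disjoint_sleBubbleSet_iff κ ω hA]
  by_cases hG : Disjoint (range (sleTrace κ ω)) A
  · rw [indicator_of_mem (show ω ∈ {ω | Disjoint (range (sleTrace κ ω)) A} from hG)]
    simp only [hG, true_and]
    rw [measure_cloud_inter_eq_empty hX (hmeas hG), bubbleCloudIntensity, Measure.smul_apply,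
      smul_eq_mul, Measure.prod_apply_symm (hmeas hG)]
    rfl
  · rw [indicator_of_notMem (show ω ∉ {ω | Disjoint (range (sleTrace κ ω)) A} from hG)]
    simp [hG]

/-- **[LSW] (7.3) from the three named facts** — the printed proof of Thm. 7.3's avoidance
formula with its measure theory carried out: by null-measurability (`hE`, the named fact
`SLEBubbles.nullMeasurableSet_disjoint` of `SLEBubblesVersion`) the event
`E = {Ξ ∩ A = ∅}` has a measurable kernel `E₀ ⊆ E` of the same measure whose `ω`-sections agree
with those of `E` for a.e. `ω` (Fubini for null sets, `Measure.ae_ae_of_ae_prod`), so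
`(P ⊗ P')(E) = ∫ P'(E_ω) dP(ω)` (`Measure.prod_apply`); by Step 1 and Step 2
(`SLEBubbles.measure_section_eq_indicator`, using `hfib`)
`P'(E_ω) = 1{γ ∩ A = ∅} exp(−λ_κ ∫₀^∞ μ{K : g_t⁻¹(K + W_t) ∩ A ≠ ∅} dt)` for a.e. `ω`; and
"applying Theorem 6.5" (`h65`) the integral is `Φ'_A(0)^{α_κ}`.
[cite: LawlerSchrammWerner2003Restriction, Thm. 7.3 with eq. (7.3) (pp. 28–29)] -/
theorem SLEBubbles.measure_disjoint_of_leaves (hE : SLEBubbles.nullMeasurableSet_disjoint)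
    (hfib : SLEBubbles.ae_measurableSet_bubbleHitSet)
    (h65 : SLEBubbles.lintegral_poissonAvoidance_eq_rpow) : SLEBubbles.measure_disjoint := by
  intro κ hκ0 hκ μ hμ Ω' _ P' X hX A hA Φ hΦ d hd
  haveI : IsProbabilityMeasure P' := hX.isProbabilityMeasure
  haveI : SigmaFinite μ := hμ.sigmaFinite
  set E : Set ((ℝ≥0 → ℝ) × Ω') := {p | Disjoint (sleBubbleSet κ p.1 (X p.2)) A} with hEdef
  -- a measurable kernel `E₀ ⊆ E` with `E₀ = E` a.e.
  obtain ⟨E₀, hE₀E, hE₀m, hE₀eq⟩ := (hE hκ0 hκ hμ hX hA).exists_measurable_subset_ae_eq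
  rw [← measure_congr hE₀eq, Measure.prod_apply hE₀m]
  -- the sections of `E₀` and `E` agree for a.e. `ω`
  have hle : ∀ᵐ p ∂preWienerMeasure.prod P', p ∈ E → p ∈ E₀ := hE₀eq.symm.le
  have hsec : ∀ᵐ ω ∂preWienerMeasure, (Prod.mk ω ⁻¹' E₀ : Set Ω') =ᵐ[P'] Prod.mk ω ⁻¹' E := by
    filter_upwards [Measure.ae_ae_of_ae_prod hle] with ω hω
    exact (show Prod.mk ω ⁻¹' E₀ ≤ Prod.mk ω ⁻¹' E from preimage_mono hE₀E).eventuallyLE.antisymm hω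
  -- Step 1 and Step 2, section by section
  have hstep : ∀ᵐ ω ∂preWienerMeasure, P' (Prod.mk ω ⁻¹' E₀) =
      {ω | Disjoint (range (sleTrace κ ω)) A}.indicator
        (fun ω ↦ poissonAvoidance
          (sleBubbleIntensity κ * ∫⁻ t, μ (bubbleHitFibre κ ω A t) ∂timeMeasure)) ω := by
    filter_upwards [hsec, hfib hκ0 hκ hA] with ω hω hmeas
    rw [measure_congr hω]
    exact SLEBubbles.measure_section_eq_indicator hX hA hmeas
  -- Step 3: Theorem 6.5
  rw [lintegral_congr_ae hstep]
  exact h65 hκ0 hκ hμ hA hΦ hd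

/-- **[LSW] (7.3) from `Ξ(κ) ∈ Ω` (measurable version), the measurability of `s_ω`, and
Theorem 6.5**: the same assembly with the null-measurability of `{Ξ ∩ A = ∅}` taken from the
sibling fact `SLEBubbles.exists_measurable_version` (`SLEBubbles.nullMeasurableSet_disjoint_of`,
file `SLEBubblesVersion`).
[cite: LawlerSchrammWerner2003Restriction, Thm. 7.3 with eq. (7.3) (pp. 28–29)] -/
theorem SLEBubbles.measure_disjoint_of_version (h₁ : SLEBubbles.exists_measurable_version)
    (hfib : SLEBubbles.ae_measurableSet_bubbleHitSet)
    (h65 : SLEBubbles.lintegral_poissonAvoidance_eq_rpow) : SLEBubbles.measure_disjoint :=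
  SLEBubbles.measure_disjoint_of_leaves (SLEBubbles.nullMeasurableSet_disjoint_of h₁) hfib h65

end Literature.Probability.RandomPlanarGeometry

end
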